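import Summits.NavierStokesRegularity.NavierStokesRegularity.Theorems.HodographBetchovFastClassSqueezeGerm

/-!
# Skeleton (BC3) for piece X₁ `NoFastEnergyConcentration` (stmt-NavierStokesRegularity-18118) of the split of
# `FastClassSqueeze` (stmt-NavierStokesRegularity-15832, route `HodographBetchov`) — line `morrey-nullset`

The piece, verbatim `Summit.NavierStokesRegularity.NavierStokesRegularity.Theses.HodographBetchov.NoFastEnergyConcentration`
(route leaf stmt-18118 = the vetted stub `stub_no_fast_energy_concentration` of `Cruxes/FastClassSqueeze/Lines/birth.lean`): along every classical solution `(u,p)` of unforced Navier–Stokes on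
`ℝ³ × [0,T)` that is Leray–Hopf from a rapidly decaying datum, for every `ε > 0` there is a speed level
`l > 0` with `∫_{|u(t)|>l} |u(t,x)|² dx ≤ ε` for all `t ∈ [0,T)` — NO ENERGY QUANTUM ESCAPES TO INFINITE SPEED.

## The line: Type-I-in-space energy bound + the `ℋ¹`-null top singular set cannot hold energy

Three landed facts frame it. (1) LOCALISATION (`Theorems.FastClassSqueeze.Germ`, `…TopSingularNull`): the
top singular set `Σ_T(u) = {x | (T,x) is a backward singular point}` is COMPACT and `ℋ¹`-NULL (CKN Theorem B at
the top slice), `u` is bounded on `[0,T) × Uᶜ` for every open `U ⊇ Σ_T(u)`, and the fast class `{|u(t)| > l}`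
lies inside any such `U` for all `t < T` once `l` is large (`Germ.exists_fastClass_subset`); on every closed early
slab `[0,τ]`, `τ < T`, `u` is bounded (`Birth.exists_forall_norm_le_on_closedSlab`). So energy can escape to
infinite speed ONLY by concentrating, as `t ↑ T`, onto the `ℋ¹`-null compact set `Σ_T(u)`.
(2) LESLIE–SHVYDKOY (ARMA 230 (2018) = arXiv:1705.04420, Prop. 3.x / Thm 1.2, "Type-I in time implies Type-I in
space"): under the Type-I-in-time bound the SCALED LOCAL ENERGY `A(r,x₀) = r⁻¹ sup_{T−r²<t<T} ∫_{B_r(x₀)} |u|²`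
is bounded uniformly in `x₀` and small `r`; and a bounded upper `1`-density of the energy measure on a
`ℋ¹`-null set forces the energy defect there to vanish (energy equality at the first blow-up time).
(3) The birth partial result `Birth.stub_no_fast_energy_concentration_of_tendsto` (piece ⇐ strong
`L²`-continuity into `T`) is the same phenomenon seen from the energy EQUALITY side.

The line cuts the piece at the Morrey bound, NOT at the rate of the velocity:

* `stub_energy_morrey_bound` — **TYPE I IN SPACE, ENERGY-WISE (open, substantive, strictly weaker than
  regularity).** Along every such flow there are `C, r₀ > 0` with `∫_{B_r(x₀)} |u(t,x)|² dx ≤ C r` for every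
  centre `x₀`, every `r ∈ (0,r₀)` and every `t ∈ [0,T)` with `t > T − r²`: the kinetic energy is a `1`-dimensional
  Morrey measure at parabolic scales under the final time (`u ∈ L^∞_t 𝓜^{2,1}` near `T`). TRUE for every
  Type-I-in-time blow-up (Leslie–Shvydkoy) and trivially without blow-up; a self-similar-rate profile `|u| ≲
  C/(|x−x₀| + √(T−t))` gives exactly `∫_{B_r} |u|² ≍ C² r`. It fails only for a blow-up that is Type II IN THE
  ENERGY SENSE (`A(r) → ∞`), which nothing in print excludes — this is the open content, and it is an
  ENERGY-level (supercritical-quantity) statement, not a velocity-rate statement.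
* `stub_tightness_of_morrey` — **A MORREY-BOUNDED ENERGY DOES NOT CONCENTRATE ON THE `ℋ¹`-NULL TOP SINGULAR SET
  (provable, L).** Along every such flow: IF the Morrey bound of stub 1 holds THEN for every `ε > 0` there are an
  open `U ⊇ Σ_T(u)` and a time `τ < T` with `∫_U |u(t,x)|² dx ≤ ε` for all `t ∈ (τ,T) ∩ [0,T)`. Proof sketch:
  `Σ_T(u)` is compact with `μH[1] = 0` (`Germ.topSingularSet_localisation`), so for `δ = ε/(2C)` it has a FINITE
  cover by balls `B(x_i,r_i)`, `r_i < r₀`, `Σ r_i < δ` (definition of `μH[1] = 0` + compactness); put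
  `U = ⋃ B(x_i,r_i)`, `τ = T − min r_i²`; for `t > τ` the Morrey bound on each ball and subadditivity of the
  set integral give `∫_U |u(t)|² ≤ C Σ r_i < ε`. (Mathlib: `MeasureTheory.Measure.hausdorffMeasure`,
  `IsCompact.elim_finite_subcover`, `MeasureTheory.lintegral_union_le` / finite unions.)

Assembly `NoFastEnergyConcentration_of` (kernel-checked below; no `sorry` outside the two stubs): feed stub 1
into stub 2 to get `U, τ`; `Germ.exists_fastClass_subset` puts the fast class of every level `l ≥ l₀` inside `U`
for all `t < T`; `Birth.exists_forall_norm_le_on_closedSlab` bounds `|u| ≤ M` on `[0, max(τ,T/2)]`; with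
`l = max(l₀, M, 0) + 1` the fast class is EMPTY up to `max(τ,T/2)` and inside `U` afterwards, where
`∫_{F_l(t)} |u|² ≤ ∫_U |u(t)|² ≤ ε` by monotonicity of the set integral.

Disproof used: none filed for this piece or for the parent crux beyond
`Theorems/FastClassSqueeze/Negative/FalseWithoutLerayHopf.lean` (`fastClassSqueeze_false_without_lerayHopf`: the
Leray–Hopf hypothesis is necessary for the PARENT) — honoured: both stubs carry `IsLerayHopfOn`, and stub 2's proof
uses the energy class through the landed localisation (far-field bound, CKN at the top slice).
Sorries: exactly the two `stub_*`. No new definitions; all constants are tree / Mathlib declarations.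
-/

set_option linter.dupNamespace false

namespace Summit.NavierStokesRegularity.NavierStokesRegularity.Cruxes.NoFastEnergyConcentration.MorreyNullset

open MeasureTheory Set
open Summit.NavierStokesRegularity.NavierStokesRegularity.Theorems.FastClassSqueeze

/-- **Stub 1 — Type I in space, energy-wise (OPEN, substantive; strictly weaker than regularity).** Along every
classical solution of unforced Navier–Stokes on `ℝ³ × [0,T)` that is Leray–Hopf from a rapidly decaying datum
there are `C, r₀ > 0` such that `∫_{B_r(x₀)} |u(t,x)|² dx ≤ C r` for every centre `x₀`, every radius
`r ∈ (0, r₀)` and every time `t ∈ [0,T)` with `T − r² < t` (the kinetic energy is a `1`-dimensional Morrey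
measure at parabolic scales under the final time). Known for Type-I-in-time blow-up (Leslie–Shvydkoy 2018,
"Type-I in time implies Type-I in space") and without blow-up; open for Type-II collapse. -/
theorem stub_energy_morrey_bound :
    ∀ (ν T : ℝ), 0 < ν → 0 < T →
      ∀ (u : ℝ → EuclideanSpace ℝ (Fin 3) → EuclideanSpace ℝ (Fin 3)) (p : ℝ → EuclideanSpace ℝ (Fin 3) → ℝ),
      Literature.Analysis.FluidPDE.IsClassicalNSSolutionOn (Set.Ico 0 T) ν 0 u p →
      Literature.Analysis.FluidPDE.IsLerayHopfOn T ν 0 (u 0) u →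
      Literature.Analysis.FluidPDE.HasRapidSpatialDecay (u 0) →
      ∃ C r₀ : ℝ, 0 < r₀ ∧ ∀ x₀ : EuclideanSpace ℝ (Fin 3), ∀ r ∈ Set.Ioo 0 r₀, ∀ t ∈ Set.Ico 0 T,
        T - r ^ 2 < t → ∫⁻ x in Metric.ball x₀ r, ‖u t x‖ₑ ^ 2 ≤ ENNReal.ofReal (C * r) := by
  sorry

/-- **Stub 2 — a Morrey-bounded energy does not concentrate on the `ℋ¹`-null top singular set (PROVABLE, L).**
Along every such flow: if the Morrey bound of stub 1 holds, then for every `ε > 0` there are an open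
`U ⊇ Σ_T(u) = {x | (T,x) is a backward singular point of u}` and a time `τ < T` with `∫_U |u(t,x)|² dx ≤ ε`
for all `t ∈ [0,T)`, `t > τ`. (Finite cover of the compact `ℋ¹`-null set `Σ_T(u)` by balls of radii `r_i < r₀`
with `Σ r_i < ε / (2C)` — `Germ.topSingularSet_localisation` —, `U` their union, `τ = T − min r_i²`,
subadditivity of the set integral.) -/
theorem stub_tightness_of_morrey :
    ∀ (ν T : ℝ), 0 < ν → 0 < T →
      ∀ (u : ℝ → EuclideanSpace ℝ (Fin 3) → EuclideanSpace ℝ (Fin 3)) (p : ℝ → EuclideanSpace ℝ (Fin 3) → ℝ),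
      Literature.Analysis.FluidPDE.IsClassicalNSSolutionOn (Set.Ico 0 T) ν 0 u p →
      Literature.Analysis.FluidPDE.IsLerayHopfOn T ν 0 (u 0) u →
      Literature.Analysis.FluidPDE.HasRapidSpatialDecay (u 0) →
      (∃ C r₀ : ℝ, 0 < r₀ ∧ ∀ x₀ : EuclideanSpace ℝ (Fin 3), ∀ r ∈ Set.Ioo 0 r₀, ∀ t ∈ Set.Ico 0 T,
        T - r ^ 2 < t → ∫⁻ x in Metric.ball x₀ r, ‖u t x‖ₑ ^ 2 ≤ ENNReal.ofReal (C * r)) →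
      ∀ ε : ℝ, 0 < ε → ∃ U : Set (EuclideanSpace ℝ (Fin 3)), IsOpen U ∧
        {x : EuclideanSpace ℝ (Fin 3) | Literature.Analysis.FluidPDE.IsBackwardSingularPoint u (T, x)} ⊆ U ∧
        ∃ τ : ℝ, τ < T ∧ ∀ t ∈ Set.Ico 0 T, τ < t →
          ∫⁻ x in U, ‖u t x‖ₑ ^ 2 ≤ ENNReal.ofReal ε := by
  sorry

/-- **Assembly: the piece BY NAME from the two registered stubs BY NAME** (kernel-checked; no direct `sorry`).
Stub 1 feeds stub 2 (spatial tightness of the energy near the top singular set for `t` close to `T`); the landed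
localisation `Germ.exists_fastClass_subset` puts every high fast class inside the neighbourhood `U`; the landed
early-slab bound `Birth.exists_forall_norm_le_on_closedSlab` empties the fast class up to `max(τ, T/2)`; the set
integral is monotone in the set. -/
theorem NoFastEnergyConcentration_of :
    Summit.NavierStokesRegularity.NavierStokesRegularity.Theses.HodographBetchov.NoFastEnergyConcentration := by
  intro ν T hν hT u p hcl hLH hdec ε hε
  obtain ⟨U, hU, hSU, τ, hτT, hsmall⟩ :=
    stub_tightness_of_morrey ν T hν hT u p hcl hLH hdec
      (stub_energy_morrey_bound ν T hν hT u p hcl hLH hdec) ε hε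
  -- every high fast class lies inside `U`, for all `t < T`
  obtain ⟨l₀, hl₀⟩ := Germ.exists_fastClass_subset hν hT hcl hLH hdec hU hSU
  -- `u` is bounded on the closed early slab `[0, τ']`, `τ' = max τ (T/2) ∈ (0,T)`
  have hτ'pos : 0 < max τ (T / 2) := lt_of_lt_of_le (by linarith) (le_max_right _ _)
  have hτ'T : max τ (T / 2) < T := max_lt hτT (by linarith)
  obtain ⟨M, hM⟩ := Birth.exists_forall_norm_le_on_closedSlab hν hcl hLH hdec hτ'pos hτ'T
  refine ⟨max (max l₀ M) 0 + 1, by positivity, fun t ht => ?_⟩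
  by_cases htτ : t ≤ max τ (T / 2)
  · -- early times: the fast class of level `max (max l₀ M) 0 + 1 > M` is empty
    have hempty : {x : EuclideanSpace ℝ (Fin 3) | max (max l₀ M) 0 + 1 < ‖u t x‖} = ∅ := by
      ext x
      simp only [Set.mem_setOf_eq, Set.mem_empty_iff_false, iff_false, not_lt]
      have hx := hM t ⟨ht.1, htτ⟩ x
      linarith [le_max_right l₀ M, le_max_left (max l₀ M) 0]
    rw [hempty, setLIntegral_empty]
    exact bot_le
  · -- late times: the fast class lies inside `U`, where the energy is `≤ ε`
    push Not at htτ
    have htτ0 : τ < t := lt_of_le_of_lt (le_max_left _ _) htτ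
    have hsub : {x : EuclideanSpace ℝ (Fin 3) | max (max l₀ M) 0 + 1 < ‖u t x‖} ⊆ U :=
      hl₀ _ (by linarith [le_max_left l₀ M, le_max_left (max l₀ M) 0]) t ht
    exact (lintegral_mono_set hsub).trans (hsmall t ht htτ0)

end Summit.NavierStokesRegularity.NavierStokesRegularity.Cruxes.NoFastEnergyConcentration.MorreyNullset
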